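import Mathlib
import HarnessLib
import Summits.HodgeConjecture.HodgeConjecture.Theorems.EightfoldBlochSeedsBlochSpreadEightFourFlatFamilyComponents
import Literature.AlgebraicGeometry.Motives.DefinitionFieldOfGeometricPoint
import Literature.NumberTheory.Transcendental.AnalytificationConnected

/-!
# Conclusion (1) of the relative-class input `(RC′)` for EVERY class supported on a flat family, over an
# arbitrary base — capstone of the (F3)/(F4)/(F4′) chain
# (crux `BlochSpreadEightFour`, stmt-HodgeConjecture-18884, line `bloch-lifts-fulton`, stub `stub_fultonSpecialises`)

HONEST FRAMING: helper file; no stub is closed and nothing here proves `BlochSpreadEightFour`, rung H2,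
HC_AV or HC. Sequel of `…FultonSupportStep` ((F3)), `…FlatFamilyFibreCodim` ((F4)),
`…FlatFamilyComponents` ((F4′)) and `…OfRelativeClassNear` ((RC′)): it removes the auxiliary hypotheses
`IsSeparated V.hom` and `IrreducibleSpace V.left` of (F4)/(F4′), so that the statement applies VERBATIM to
the base `V` of Bloch's étale neighbourhood in the glue `semiregularSpread_of_blochLifts_of_relativeClassNear`.

## What is proved (sorry-free; no definition, no named fact)

* `exists_iso_fromSpecResidueField_of_complexPoint` — for a complex point `t` of ANY `ℂ`-scheme,
  `κ(t.pt) ⟶ ℂ` is an isomorphism (a field homomorphism onto: its image contains the constants,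
  `AlgPoints.algebraMap_mem_range_resHom`), so `Spec ℂ ≅ Spec κ(t.pt)` over `V`; hence
  `exists_iso_fiberOver_fiber'`, `exists_fiber_coheight_eq'`, `base_fiberι_left_base` (the tree's fibre
  `Motives.fiberOver g t` versus Mathlib's `g.left.fiber t.pt`, no separatedness).
* `add_coheight_le_coheight_apply_of_strictMono'`, `le_coheight_fiber_of_flat'` — (F4) localised: only the
  maximal generisations of the point at hand need codimension `≥ p`.
* `isMax_apply_of_isMax_of_flat`, `closure_singleton_mem_irreducibleComponents_of_isMax'` — flat maps send
  maximal points to maximal points; maximal points are generic points of irreducible components.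
* `le_coheight_of_isMax_of_flat_family'` — (F4′) for one maximal point `ξ` of `𝒲` with `g (ι ξ) ⤳ v₀.pt`,
  over an arbitrary locally Noetherian base.
* `exists_isOpen_forall_map_fiberι_mem_algebraicClasses_of_flat_family` — **CAPSTONE**: for
  `g : 𝒳 ⟶ V` flat and universally closed (`𝒳, V, 𝒲` locally Noetherian), regular local rings of `𝒳`
  along `𝒳_{v₀}`, `ι : 𝒲 ↪ 𝒳` closed with `ι ≫ g` flat, the fibre binder at `v₀` ("points of `𝒳_{v₀}` on
  `𝒲` have codimension `≥ p`"), and ANY global class `Γ ∈ H²ᵖ(𝒳(ℂ); ℂ)` supported on `ι(𝒲)`: there is a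
  Zariski-open `U₁ ∋ v₀.pt` (the complement of the irreducible components of `V` missing `v₀.pt`, a
  locally finite union of closed sets) with `Γ|_{𝒳_t} ∈ algebraicClasses (𝒳_t) p` for all `t ∈ V(ℂ)`,
  `t.pt ∈ U₁` — exactly the algebraicity clause of `(RC′)`.

So, for the line `bloch-lifts-fulton`, the Fulton-side input `(RC′)` of
`BlochSpreadEightFour_of_blochLifts_of_relativeClassNear` is now reduced to the EXISTENCE statement
(F1) + (F5b): a global class on `𝒳 ×_S V` supported on Bloch's flat lift `𝒵` whose restriction to the
central fibre is non-zero (the hypotheses of the capstone hold there: the base change of a smooth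
projective family is flat and universally closed, `𝒳 ×_S V` is smooth over `ℂ`, hence has regular local
rings, and the fibre binder is the codimension of the integral seed `Z₀`).

References: [Hartshorne1977] II.3, II Ex. 3.20, III Prop. 9.5, Cor. 9.6; [Matsumura1987] Thm. 15.1 (i),
Thm. 17.4 (ii); [Fulton1998] §10.1 Prop. 10.1 (a), §19.1 eq. (1); [GortzWedhorn2020] §(5.2);
[StacksProject] Tags 01J7, 02IZ, 0BA8.
-/

-- every declaration of this problem lives in `Summit.HodgeConjecture.HodgeConjecture.…` (summit = sub-problem)
set_option linter.dupNamespace false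

noncomputable section

open CategoryTheory CategoryTheory.Limits AlgebraicGeometry Order
open Literature.AlgebraicGeometry.Motives Literature.AlgebraicGeometry.HodgeTheory
open Literature.AlgebraicGeometry.Resolution IsLocalRing

namespace Summit.HodgeConjecture.HodgeConjecture.Theorems

/-! ### The two fibres over a complex point, without separatedness -/

/-- For a complex point `t` of ANY `ℂ`-scheme `V`, the residue embedding `κ(t.pt) ⟶ ℂ` is an
isomorphism (it is a field homomorphism whose image contains the constants `ℂ`), so `Spec ℂ` and
`Spec κ(t.pt)` are isomorphic over `V`. [cite: GortzWedhorn2020, §(5.2)] -/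
theorem exists_iso_fromSpecResidueField_of_complexPoint {V : SchemeOver ℂ} (t : ComplexPoints V) :
    ∃ φ : (specOver ℂ ℂ).left ≅ Spec (V.left.residueField t.pt),
      φ.hom ≫ V.left.fromSpecResidueField t.pt = t.left := by
  have hbij : Function.Bijective t.resHom := by
    refine ⟨t.resHom.hom.injective, fun c => ?_⟩
    obtain ⟨a, ha⟩ := AlgPoints.algebraMap_mem_range_resHom t c
    exact ⟨a, by simpa using ha⟩
  haveI : IsIso t.resHom := (ConcreteCategory.isIso_iff_bijective t.resHom).mpr hbij
  refine ⟨Scheme.Spec.mapIso (asIso t.resHom).op, ?_⟩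
  exact (V.left.SpecToEquivOfField ℂ).symm_apply_apply t.left

/-- The tree's fibre `Motives.fiberOver g t` and Mathlib's `g.left.fiber t.pt` are isomorphic over `𝒳`,
for a complex point of ANY `ℂ`-scheme (no separatedness; compare `exists_iso_fiberOver_fiber`).
[cite: Hartshorne1977, II.3 (fibre of a morphism, p. 89)] -/
theorem exists_iso_fiberOver_fiber' {𝒳 V : SchemeOver ℂ} (g : 𝒳 ⟶ V) (t : ComplexPoints V) :
    ∃ e : (fiberOver g t).left ≅ g.left.fiber t.pt,
      e.hom ≫ g.left.fiberι t.pt = (fiberι g t).left := by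
  obtain ⟨φ, hφ⟩ := exists_iso_fromSpecResidueField_of_complexPoint t
  have H1 : IsPullback (pullback.fst g.left t.left) (pullback.snd g.left t.left) g.left
      (φ.hom ≫ V.left.fromSpecResidueField t.pt) := by
    rw [hφ]; exact IsPullback.of_hasPullback _ _
  have H2 : IsPullback (g.left.fiberι t.pt) (g.left.fiberToSpecResidueField t.pt) g.left
      (V.left.fromSpecResidueField t.pt) := IsPullback.of_hasPullback _ _
  have main : ∃ e : pullback g.left t.left ≅ g.left.fiber t.pt,
      e.hom ≫ g.left.fiberι t.pt = pullback.fst g.left t.left := by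
    have Q := IsPullback.of_right' H1 H2
    haveI := Q.isIso_fst_of_isIso (inferInstance : IsIso φ.hom)
    exact ⟨asIso (H2.lift (pullback.fst g.left t.left) (pullback.snd g.left t.left ≫ φ.hom)
        (H1.w.trans (Category.assoc _ _ _).symm)), H2.lift_fst _ _ _⟩
  exact main

/-- Codimension in `fiberOver g t` equals codimension in `g.left.fiber t.pt` at corresponding points,
for a complex point of any `ℂ`-scheme. [cite: Hartshorne1977, II.3 (fibre of a morphism, p. 89)] -/
theorem exists_fiber_coheight_eq' {𝒳 V : SchemeOver ℂ} (g : 𝒳 ⟶ V) (t : ComplexPoints V)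
    (z : (fiberOver g t).left) :
    ∃ y : ↥(g.left.fiber t.pt), (g.left.fiberι t.pt).base y = (fiberι g t).left.base z ∧
      coheight y = coheight z := by
  obtain ⟨e, he⟩ := exists_iso_fiberOver_fiber' g t
  refine ⟨e.hom.base z, ?_, coheight_eq_of_isOpenImmersion e.hom⟩
  rw [← Scheme.Hom.comp_apply, he]

/-! ### (F4) localised at a point of the family -/

/-- Order lemma, local form: as `add_coheight_le_coheight_apply_of_strictMono`, with the hypothesis on
maximal elements only required ABOVE `x`. [folklore] -/
theorem add_coheight_le_coheight_apply_of_strictMono' {α β : Type*} [Preorder α] [Preorder β]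
    (f : α → β) (hf : StrictMono f) {p : ℕ} (x : α)
    (h : ∀ a : α, x ≤ a → IsMax a → (p : ℕ∞) ≤ coheight (f a))
    (hx : coheight x < ⊤) : (p : ℕ∞) + coheight x ≤ coheight (f x) := by
  obtain ⟨n, hn⟩ := ENat.ne_top_iff_exists.mp hx.ne
  rw [← hn]
  obtain ⟨s, hhead, hlen⟩ := exists_series_of_coheight_eq_coe x hn.symm
  have hmax : IsMax s.last := by
    intro y hy
    by_contra hyx
    have hlt : s.last < y := lt_of_le_not_ge hy hyx
    have h1 := length_le_coheight_head (p := s.snoc y hlt)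
    rw [RelSeries.head_snoc, RelSeries.snoc_length, hhead, ← hn, hlen] at h1
    exact absurd (by exact_mod_cast h1 : n + 1 ≤ n) (by omega)
  have hxlast : x ≤ s.last := by
    rw [← hhead]
    exact (LTSeries.monotone s) (Fin.zero_le _)
  obtain ⟨r, hrhead, hrlen⟩ := exists_series_of_le_coheight (f s.last) (h _ hxlast hmax)
  have hconn : (s.map f hf).last = r.head := by rw [LTSeries.last_map, hrhead]
  have h2 := length_le_coheight_head (p := RelSeries.smash (s.map f hf) r hconn)
  rw [RelSeries.head_smash, LTSeries.head_map, hhead, RelSeries.smash_length, LTSeries.map_length,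
    hlen, hrlen] at h2
  calc (p : ℕ∞) + (n : ℕ∞) = ((n + p : ℕ) : ℕ∞) := by push_cast; ring
    _ ≤ coheight (f x) := h2

/-- **(F4) at one point of the family.** For `ι : W ⟶ X` a closed immersion, `g : X ⟶ V` with `g` and
`ι ≫ g` flat (locally Noetherian schemes), `ζ ∈ W`, and every maximal generisation `ξ` of `ζ` in `W` of
codimension `≥ p` in `X`: every point `y` of the scheme-theoretic fibre of `g` lying over `ι ζ` has
codimension `≥ p` in that fibre. [cite: Hartshorne1977, III Prop. 9.5] [cite: Matsumura1987, Thm. 15.1] -/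
theorem le_coheight_fiber_of_flat' {W X V : Scheme} (ι : W ⟶ X) (g : X ⟶ V) [IsClosedImmersion ι]
    [Flat g] [Flat (ι ≫ g)] [IsLocallyNoetherian W] [IsLocallyNoetherian X] [IsLocallyNoetherian V]
    {p : ℕ} (ζ : W) (h : ∀ ξ : W, ζ ≤ ξ → IsMax ξ → (p : ℕ∞) ≤ coheight (ι.base ξ)) {s : V}
    (y : ↥(g.fiber s)) (hy : (g.fiberι s).base y = ι.base ζ) : (p : ℕ∞) ≤ coheight y := by
  have hs : g.base (ι.base ζ) = s := by
    have hmem : ι.base ζ ∈ Set.range (g.fiberι s).base := ⟨y, hy⟩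
    rw [Scheme.Hom.range_fiberι] at hmem
    simpa using hmem
  subst hs
  have hy' : y = g.asFiber (ι.base ζ) :=
    (g.fiberι (g.base (ι.base ζ))).isEmbedding.injective (by rw [hy, Scheme.Hom.fiberι_asFiber])
  subst hy'
  have hA := Literature.AlgebraicGeometry.Motives.coheight_eq_coheight_add_coheight_asFiber g (ι.base ζ)
  have hB := Literature.AlgebraicGeometry.Motives.coheight_eq_coheight_add_coheight_asFiber (ι ≫ g) ζ
  have hC := add_coheight_le_coheight_apply_of_strictMono' _
    (strictMono_base_of_isEmbedding ι ι.isEmbedding) ζ h (coheight_lt_top_of_isLocallyNoetherian ζ)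
  have htfin : coheight (g.base (ι.base ζ)) ≠ ⊤ :=
    (coheight_lt_top_of_isLocallyNoetherian _).ne
  have hcomp : (ι ≫ g).base ζ = g.base (ι.base ζ) := rfl
  have hB' : coheight (g.base (ι.base ζ)) ≤ coheight ζ := by
    rw [← hcomp, hB]; exact le_self_add
  have h1 : (p : ℕ∞) + coheight (g.base (ι.base ζ)) ≤
      coheight (g.base (ι.base ζ)) + coheight (g.asFiber (ι.base ζ)) :=
    calc (p : ℕ∞) + coheight (g.base (ι.base ζ)) ≤ (p : ℕ∞) + coheight ζ := by gcongr
      _ ≤ coheight (ι.base ζ) := hC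
      _ = _ := hA
  rw [add_comm (p : ℕ∞)] at h1
  exact (WithTop.add_le_add_iff_left htfin).mp h1

/-! ### (F4′) without irreducibility of the base -/

/-- A flat morphism maps maximal points to maximal points (flat ⇒ generalising). [folklore] -/
theorem isMax_apply_of_isMax_of_flat {W V : Scheme} (f : W ⟶ V) [Flat f] {ξ : W} (hξ : IsMax ξ) :
    IsMax (f.base ξ) := by
  intro v hv
  obtain ⟨ξ', hξ'ξ, hξ'v⟩ := Flat.generalizingMap f (Scheme.le_iff_specializes.1 hv)
  have h1 : ξ ⤳ ξ' := Scheme.le_iff_specializes.1 (hξ (Scheme.le_iff_specializes.2 hξ'ξ))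
  have : ξ' = ξ := (hξ'ξ.antisymm h1).eq
  rw [← hξ'v, this]

/-- **(F4′) for ONE maximal point whose image specialises to the marked point** (no irreducibility of
the base): as `le_coheight_of_isMax_of_flat_family`, the hypothesis `IrreducibleSpace V` being replaced
by `g (ι ξ) ⤳ v₀.pt` for the maximal point `ξ` at hand, and separatedness of `V` dropped.
[cite: Hartshorne1977, III Prop. 9.5] [cite: Matsumura1987, Thm. 15.1 and Thm. 17.4 (ii)] -/
theorem le_coheight_of_isMax_of_flat_family' {𝒳 V : SchemeOver ℂ} (g : 𝒳 ⟶ V)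
    [Flat g.left] [UniversallyClosed g.left] [IsLocallyNoetherian 𝒳.left] [IsLocallyNoetherian V.left]
    {𝒲 : Scheme} (ι : 𝒲 ⟶ 𝒳.left) [IsClosedImmersion ι] [Flat (ι ≫ g.left)]
    (v₀ : ComplexPoints V)
    (hXreg : ∀ x : 𝒳.left, g.left.base x = v₀.pt → IsRegularLocalRing (𝒳.left.presheaf.stalk x))
    {p : ℕ} (hcodim : ∀ z : (fiberOver g v₀).left,
      (fiberι g v₀).left.base z ∈ Set.range ι.base → (p : ℕ∞) ≤ coheight z)
    (ξ : 𝒲) (hξv : g.left.base (ι.base ξ) ⤳ v₀.pt) : (p : ℕ∞) ≤ coheight (ι.base ξ) := by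
  classical
  -- points of `cl(ι ξ)` over `v₀`
  have hS : ∃ n : ℕ, ∃ x : 𝒳.left, ι.base ξ ⤳ x ∧ g.left.base x = v₀.pt ∧ coheight x = n := by
    have hclosed : IsClosed (g.left.base '' closure {ι.base ξ}) :=
      g.left.isClosedMap _ isClosed_closure
    have hv : v₀.pt ∈ g.left.base '' closure {ι.base ξ} :=
      hclosed.closure_subset_iff.2
        (Set.singleton_subset_iff.2 ⟨ι.base ξ, subset_closure rfl, rfl⟩) hξv.mem_closure
    obtain ⟨x, hx, hxv⟩ := hv
    obtain ⟨n, hn⟩ := ENat.ne_top_iff_exists.mp (coheight_lt_top_of_isLocallyNoetherian x).ne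
    exact ⟨n, x, specializes_iff_mem_closure.2 hx, hxv, hn.symm⟩
  obtain ⟨x₀, hx₀, hx₀v, hx₀n⟩ := Nat.find_spec hS
  have hmin : ∀ y : 𝒳.left, ι.base ξ ⤳ y → y ⤳ x₀ → g.left.base y = v₀.pt → y = x₀ := by
    intro y hy hyx hyv
    by_contra hne
    have hlt : x₀ < y := by
      refine lt_iff_le_not_ge.2 ⟨Scheme.le_iff_specializes.2 hyx, fun hle => hne ?_⟩
      exact (hyx.antisymm (Scheme.le_iff_specializes.1 hle)).eq
    have hfin := coheight_lt_top_of_isLocallyNoetherian y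
    have hlt' := coheight_strictAnti hlt hfin
    obtain ⟨m, hm⟩ := ENat.ne_top_iff_exists.mp hfin.ne
    have hmn : m < Nat.find hS := by
      rw [← hm, hx₀n] at hlt'
      exact_mod_cast hlt'
    exact Nat.find_min hS hmn ⟨y, hy, hyv, hm.symm⟩
  haveI := hXreg x₀ hx₀v
  have hcat := coheight_eq_coheight_add_coheight_closure_of_isRegularLocalRing hx₀
  have hsharp := coheight_closure_le_add_coheight_fibre g.left hx₀
  have hfib : coheight (⟨x₀, ⟨specializes_iff_mem_closure.mp hx₀, rfl⟩⟩ :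
      ↥(closure ({ι.base ξ} : Set 𝒳.left) ∩ g.left.base ⁻¹' {g.left.base x₀})) = 0 := by
    rw [coheight_eq_zero]
    intro y hy
    have hyx : (y : 𝒳.left) ⤳ x₀ := Scheme.le_iff_specializes.1 hy
    have hy1 : ι.base ξ ⤳ (y : 𝒳.left) := specializes_iff_mem_closure.2 y.2.1
    have hy2 : g.left.base y = v₀.pt := by rw [← hx₀v]; exact y.2.2
    have heq := hmin y hy1 hyx hy2
    apply Scheme.le_iff_specializes.2
    rw [heq]
  have hbase : coheight (⟨g.left.base x₀, specializes_iff_mem_closure.mp (hx₀.map g.left.continuous)⟩ :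
      ↥(closure ({g.left.base (ι.base ξ)} : Set V.left))) ≤ coheight (g.left.base x₀) :=
    coheight_le_coheight_apply_of_strictMono
      (fun v : ↥(closure ({g.left.base (ι.base ξ)} : Set V.left)) => (v : V.left))
      (Subtype.strictMono_coe _) _
  rw [hfib, add_zero] at hsharp
  have hb : coheight (⟨x₀, specializes_iff_mem_closure.mp hx₀⟩ : ↥(closure ({ι.base ξ} : Set 𝒳.left))) ≤
      coheight v₀.pt := by
    rw [← hx₀v]; exact hsharp.trans hbase
  obtain ⟨e, he⟩ := exists_iso_fiberOver_fiber' g v₀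
  set y₀ : ↥(g.left.fiber v₀.pt) := (g.left.fiberHomeo v₀.pt).symm ⟨x₀, hx₀v⟩ with hy₀
  have hy₀x : (g.left.fiberι v₀.pt).base y₀ = x₀ := g.left.fiberι_fiberHomeo_symm _ _
  have hH := coheight_eq_coheight_add_coheight_of_fiberι_eq g.left y₀ hy₀x
  have hz₀x : (fiberι g v₀).left.base (e.inv.base y₀) = x₀ := by
    rw [← he, ← Scheme.Hom.comp_apply, e.inv_hom_id_assoc, hy₀x]
  have hzy : coheight (e.inv.base y₀) = coheight y₀ := coheight_eq_of_isOpenImmersion e.inv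
  have hx₀range : x₀ ∈ Set.range ι.base :=
    ι.isClosedEmbedding.isClosed_range.closure_subset_iff.2
      (Set.singleton_subset_iff.2 ⟨ξ, rfl⟩) (specializes_iff_mem_closure.1 hx₀)
  have hpz : (p : ℕ∞) ≤ coheight y₀ := by
    rw [← hzy]
    exact hcodim _ (by rw [hz₀x]; exact hx₀range)
  have hr : coheight v₀.pt ≠ ⊤ := (coheight_lt_top_of_isLocallyNoetherian _).ne
  have key : coheight v₀.pt + (p : ℕ∞) ≤ coheight v₀.pt + coheight (ι.base ξ) :=
    calc coheight v₀.pt + (p : ℕ∞) ≤ coheight v₀.pt + coheight y₀ := by gcongr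
      _ = coheight x₀ := hH.symm
      _ = coheight (ι.base ξ) + coheight (⟨x₀, specializes_iff_mem_closure.mp hx₀⟩ :
            ↥(closure ({ι.base ξ} : Set 𝒳.left))) := hcat
      _ ≤ coheight (ι.base ξ) + coheight v₀.pt := by gcongr
      _ = coheight v₀.pt + coheight (ι.base ξ) := add_comm _ _
  exact (WithTop.add_le_add_iff_left hr).mp key

/-! ### The Zariski-open neighbourhood and the capstone -/

/-- A point maximal for the specialisation order (`a ≤ b ↔ b ⤳ a`) is the generic point of an
irreducible component: `closure {z} ∈ irreducibleComponents` (schemes are sober; the argument of the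
tree's private `closure_singleton_mem_irreducibleComponents_of_isMax`). [folklore] -/
theorem closure_singleton_mem_irreducibleComponents_of_isMax' {Z : Scheme} {z : Z} (hz : IsMax z) :
    closure ({z} : Set Z) ∈ irreducibleComponents Z := by
  refine ⟨isIrreducible_singleton.closure, fun T hT hzT ↦ ?_⟩
  have hγ := hT.isGenericPoint_genericPoint_closure
  have hzT' : z ∈ closure T := subset_closure.trans (hzT.trans subset_closure) (Set.mem_singleton z)
  have hγz : hT.genericPoint ⤳ z := hγ.specializes hzT'
  have hzγ : z ⤳ hT.genericPoint :=
    Scheme.le_iff_specializes.1 (hz (Scheme.le_iff_specializes.2 hγz))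
  calc T ⊆ closure T := subset_closure
    _ = closure {hT.genericPoint} := hγ.symm
    _ ⊆ closure {z} := by
        rw [← specializes_iff_closure_subset]
        exact hzγ

/-- A point of the fibre `Motives.fiberOver g t` maps to `t.pt` in the base. [folklore] -/
theorem base_fiberι_left_base {𝒳 V : SchemeOver ℂ} (g : 𝒳 ⟶ V) (t : ComplexPoints V)
    (z : (fiberOver g t).left) : g.left.base ((fiberι g t).left.base z) = t.pt := by
  obtain ⟨y, hy, -⟩ := exists_fiber_coheight_eq' g t z
  rw [← hy]
  exact Literature.AlgebraicGeometry.Motives.base_fiberι_base g.left t.pt y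

/-- **Capstone: conclusion (1) of `(RC′)` for every class supported on the flat family, with no
hypothesis on the base beyond local Noetherianity.** For `g : 𝒳 ⟶ V` flat and universally closed
(`𝒳`, `V`, `𝒲` locally Noetherian), regular local rings of `𝒳` along `𝒳_{v₀}`, `ι : 𝒲 ↪ 𝒳` a closed
immersion with `ι ≫ g` flat, the fibre binder "points of `𝒳_{v₀}` on `𝒲` have codimension `≥ p` in
`𝒳_{v₀}`", and a global class `Γ` supported on `ι(𝒲)`: there is a Zariski-open `U₁ ∋ v₀.pt` — the
complement of the irreducible components of `V` missing `v₀.pt` (locally finite, hence closed union) —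
such that `Γ|_{𝒳_t}` is algebraic for every `t ∈ V(ℂ)` with `t.pt ∈ U₁`. Over `U₁` every irreducible
component of `𝒲` through a point of `𝒳_t` dominates a component of `V` through `v₀.pt` (flat ⇒ its
maximal point maps to a maximal point of `V`, whose closure contains `t.pt ∈ U₁`, hence `v₀.pt`), so
(F4′) (`le_coheight_of_isMax_of_flat_family'`), (F4) (`le_coheight_fiber_of_flat'`) and the support step
(F3) apply. [cite: Fulton1998, §10.1 Prop. 10.1 (a); §19.1 eq. (1)] [cite: Hartshorne1977, III Prop. 9.5]
[cite: Matsumura1987, Thm. 15.1] -/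
theorem exists_isOpen_forall_map_fiberι_mem_algebraicClasses_of_flat_family {𝒳 V : SchemeOver ℂ}
    (g : 𝒳 ⟶ V) [Flat g.left] [UniversallyClosed g.left] [IsLocallyNoetherian 𝒳.left]
    [IsLocallyNoetherian V.left] {𝒲 : Scheme} (ι : 𝒲 ⟶ 𝒳.left) [IsClosedImmersion ι]
    [Flat (ι ≫ g.left)] [IsLocallyNoetherian 𝒲] (v₀ : ComplexPoints V)
    (hXreg : ∀ x : 𝒳.left, g.left.base x = v₀.pt → IsRegularLocalRing (𝒳.left.presheaf.stalk x))
    {p : ℕ} (hcodim : ∀ z : (fiberOver g v₀).left,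
      (fiberι g v₀).left.base z ∈ Set.range ι.base → (p : ℕ∞) ≤ coheight z)
    {Γ : complexBetti 𝒳 (2 * p)} (hΓ : Γ ∈ classesSupportedOn 𝒳 (Set.range ι.base) (2 * p)) :
    ∃ U₁ : Set V.left, IsOpen U₁ ∧ v₀.pt ∈ U₁ ∧ ∀ t : ComplexPoints V, t.pt ∈ U₁ →
      complexBetti.map (fiberι g t) (2 * p) Γ ∈ algebraicClasses (fiberOver g t) p := by
  -- the open neighbourhood: off the irreducible components of `V` missing `v₀.pt`
  let J := {C : irreducibleComponents V.left // v₀.pt ∉ (C : Set V.left)}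
  let U₁ : Set V.left := (⋃ i : J, (i.1 : Set V.left))ᶜ
  have hlf := Literature.NumberTheory.Transcendental.locallyFinite_irreducibleComponents V.left
  have hclosed : IsClosed (⋃ i : J, (i.1 : Set V.left)) :=
    (hlf.comp_injective Subtype.val_injective).isClosed_iUnion
      fun i => isClosed_of_mem_irreducibleComponents _ i.1.2
  refine ⟨U₁, hclosed.isOpen_compl, ?_, fun t ht => ?_⟩
  · simp only [U₁, Set.mem_compl_iff, Set.mem_iUnion, not_exists]
    exact fun i hi => i.2 hi
  refine map_fiberι_mem_algebraicClasses_of_mem_classesSupportedOn g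
    ι.isClosedEmbedding.isClosed_range hΓ t fun z hz => ?_
  obtain ⟨ζ, hζ⟩ := hz
  obtain ⟨y, hy, hyz⟩ := exists_fiber_coheight_eq' g t z
  rw [← hyz]
  refine le_coheight_fiber_of_flat' ι g.left ζ (fun ξ hζξ hξ => ?_) y (by rw [hy, hζ])
  -- the component of `𝒲` with generic point `ξ` lies over a component of `V` through `t.pt` and `v₀.pt`
  refine le_coheight_of_isMax_of_flat_family' g ι v₀ hXreg hcodim ξ ?_
  have hmaxV : IsMax (g.left.base (ι.base ξ)) := isMax_apply_of_isMax_of_flat (ι ≫ g.left) hξ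
  have hC := closure_singleton_mem_irreducibleComponents_of_isMax' hmaxV
  have htC : t.pt ∈ closure ({g.left.base (ι.base ξ)} : Set V.left) := by
    have h1 : g.left.base (ι.base ξ) ⤳ g.left.base (ι.base ζ) :=
      ((Scheme.le_iff_specializes.1 hζξ).map ι.continuous).map g.left.continuous
    rw [hζ, base_fiberι_left_base] at h1
    exact h1.mem_closure
  have hv₀C : v₀.pt ∈ closure ({g.left.base (ι.base ξ)} : Set V.left) := by
    by_contra hnot
    apply ht
    exact Set.mem_iUnion.2 ⟨⟨⟨_, hC⟩, hnot⟩, htC⟩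
  exact specializes_iff_mem_closure.2 hv₀C

end Summit.HodgeConjecture.HodgeConjecture.Theorems

end
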